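import Literature.Probability.RandomPlanarGeometry.SLEBubblesClosedFillAssembly
import Literature.Probability.RandomPlanarGeometry.SLEBubblesThm65Kappa
import HarnessLib

/-!
# [LSW] p. 5 results 1–2, Thm. 7.3, Cor. 8.5–8.6 from ONE remaining leaf: the Brownian bubble measure

G. F. Lawler, O. Schramm, W. Werner, *Conformal restriction: the chordal case*, J. Amer. Math.
Soc. **16** (2003) 917–955, arXiv:math/0209343 (**[LSW]**): p. 5 result 1 ("`P_α` exists iff
`α ≥ 5/8`"), result 2 (uniqueness and the characterisation of `5/8`), Thm. 7.3 (SLE_κ with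
Brownian bubbles), Cor. 8.5–8.6.

`SLEBubblesClosedFillAssembly` reduced all of these to TWO named facts: a Brownian bubble measure
(`exists_isBrownianBubbleMeasure`, §7.1) and Theorem 6.5 read through (7.2)
(`SLEBubbles.lintegral_poissonAvoidance_eq_rpow`). The latter is now a THEOREM of the tree
(`SLEBubbles.lintegral_poissonAvoidance_eq_rpow_holds`, `SLEBubblesThm65Kappa`: the compensated
restriction martingale of Prop. 5.3 for `0 < κ ≤ 8/3`, Lemmas 6.2/6.3, Lemma 2.1 and side-part
domination), so every consequence depends on the single remaining leaf
`exists_isBrownianBubbleMeasure` (§7.1, eqs. (7.1)–(7.2): the σ-finite measure of Brownian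
bubbles at `0` with the hitting masses `−SΦ_A(0)/6`):

* `exists_isRestrictionMeasure_of_five_eighths_le_of_bubble_measure` — `P_α` exists for `α ≥ 5/8`;
* `exists_isRestrictionMeasure_iff_of_bubble_measure` — p. 5 result 1
  (`exists_isRestrictionMeasure_iff`);
* `not_exists_isRestrictionMeasure_of_lt_five_eighths_of_bubble_measure` — Cor. 8.6;
* `exists_isRightRestrictionMeasure_of_bubble_measure`, `…_lt_five_eighths_…` — Thm. 8.4 / Cor. 8.5;
* `IsRestrictionMeasure.ae_interior_nonempty_of_gt_five_eighths_of_bubble_measure`,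
  `…eq_five_eighths_of_outer_simple…`, `…eq_five_eighths_of_simple…`,
  `LawlerSchrammWerner2003_unique_of_bubble_measure` — p. 5 result 2.

## References

* [LSW] p. 5 results 1–2; Thm. 6.5 (§6); §7.1–7.2, Thm. 7.3; Thm. 8.4, Cor. 8.5–8.6. [LawlerSchrammWerner2003Restriction]
-/

noncomputable section

namespace Literature.Probability.RandomPlanarGeometry

/-- **`P_α` exists for every `α ≥ 5/8`, from the Brownian bubble measure alone** ([LSW] Thm. 7.3
and the sentence after its proof). [cite: LawlerSchrammWerner2003Restriction, Thm. 7.3 (p. 29)] -/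
theorem exists_isRestrictionMeasure_of_five_eighths_le_of_bubble_measure (hμex : exists_isBrownianBubbleMeasure)
    {α : ℝ} (hα : 5 / 8 ≤ α) : ∃ P : MeasureTheory.Measure RestrictionConfig, IsRestrictionMeasure α P :=
  exists_isRestrictionMeasure_of_five_eighths_le_of_two_bubble_leaves hμex
    SLEBubbles.lintegral_poissonAvoidance_eq_rpow_holds hα

/-- **[LSW] p. 5 result 1 (`exists_isRestrictionMeasure_iff`: for `α > 0`, `P_α` exists iff
`α ≥ 5/8`) from the Brownian bubble measure alone.**
[cite: LawlerSchrammWerner2003Restriction, p. 5 result 1; Thm. 7.3 (p. 29); Cor. 8.6 (pp. 37–38)] -/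
theorem exists_isRestrictionMeasure_iff_of_bubble_measure (hμex : exists_isBrownianBubbleMeasure) :
    exists_isRestrictionMeasure_iff :=
  exists_isRestrictionMeasure_iff_of_two_bubble_leaves hμex SLEBubbles.lintegral_poissonAvoidance_eq_rpow_holds

/-- **[LSW] Cor. 8.6 (`P_α` does not exist for `α < 5/8`) from the Brownian bubble measure alone.**
[cite: LawlerSchrammWerner2003Restriction, Cor. 8.6 (pp. 37–38)] -/
theorem not_exists_isRestrictionMeasure_of_lt_five_eighths_of_bubble_measure (hμex : exists_isBrownianBubbleMeasure) :
    not_exists_isRestrictionMeasure_of_lt_five_eighths :=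
  not_exists_isRestrictionMeasure_of_lt_five_eighths_of_two_bubble_leaves hμex
    SLEBubbles.lintegral_poissonAvoidance_eq_rpow_holds

/-- **The right-sided restriction measures exist ([LSW] Thm. 8.4), from the Brownian bubble measure alone.**
[cite: LawlerSchrammWerner2003Restriction, Thm. 8.4 (p. 37)] -/
theorem exists_isRightRestrictionMeasure_of_bubble_measure (hμex : exists_isBrownianBubbleMeasure) :
    exists_isRightRestrictionMeasure :=
  exists_isRightRestrictionMeasure_of_two_bubble_leaves hμex SLEBubbles.lintegral_poissonAvoidance_eq_rpow_holds

/-- **Right-sided restriction measures of exponent `< 5/8` charging `i` exist ([LSW] Cor. 8.5 /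
proof of Cor. 8.6), from the Brownian bubble measure alone.** [cite: LawlerSchrammWerner2003Restriction, Cor. 8.5–8.6 (pp. 37–38)] -/
theorem exists_isRightRestrictionMeasure_lt_five_eighths_of_bubble_measure (hμex : exists_isBrownianBubbleMeasure) :
    exists_isRightRestrictionMeasure_lt_five_eighths :=
  exists_isRightRestrictionMeasure_lt_five_eighths_of_two_bubble_leaves hμex
    SLEBubbles.lintegral_poissonAvoidance_eq_rpow_holds

/-- **`P_α` with interior points for every `α > 5/8`, from the Brownian bubble measure alone.**
[cite: LawlerSchrammWerner2003Restriction, Thm. 7.3 (p. 29) and p. 5 result 2] -/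
theorem exists_isRestrictionMeasure_ae_interior_nonempty_of_bubble_measure (hμex : exists_isBrownianBubbleMeasure) :
    exists_isRestrictionMeasure_ae_interior_nonempty :=
  exists_isRestrictionMeasure_ae_interior_nonempty_of_two_bubble_leaves hμex
    SLEBubbles.lintegral_poissonAvoidance_eq_rpow_holds

/-- **For `α > 5/8`, `P_α`-a.e. sample has interior points, from the Brownian bubble measure alone.**
[cite: LawlerSchrammWerner2003Restriction, p. 5 result 2 with Thm. 7.3] -/
theorem IsRestrictionMeasure.ae_interior_nonempty_of_gt_five_eighths_of_bubble_measure (hμex : exists_isBrownianBubbleMeasure) :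
    IsRestrictionMeasure.ae_interior_nonempty_of_gt_five_eighths :=
  IsRestrictionMeasure.ae_interior_nonempty_of_gt_five_eighths_of_two_bubble_leaves hμex
    SLEBubbles.lintegral_poissonAvoidance_eq_rpow_holds

/-- **`α = 5/8` is the only exponent whose measure charges sets with simple outer boundary, from the
Brownian bubble measure alone.** [cite: LawlerSchrammWerner2003Restriction, p. 5 result 2] -/
theorem IsRestrictionMeasure.eq_five_eighths_of_outer_simple_of_bubble_measure (hμex : exists_isBrownianBubbleMeasure) :
    IsRestrictionMeasure.eq_five_eighths_of_outer_simple :=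
  IsRestrictionMeasure.eq_five_eighths_of_outer_simple_of_two_bubble_leaves hμex
    SLEBubbles.lintegral_poissonAvoidance_eq_rpow_holds

/-- **`α = 5/8` is the only exponent supported on simple curves, from the Brownian bubble measure
alone.** [cite: LawlerSchrammWerner2003Restriction, p. 5 result 2] -/
theorem IsRestrictionMeasure.eq_five_eighths_of_simple_of_bubble_measure (hμex : exists_isBrownianBubbleMeasure) :
    IsRestrictionMeasure.eq_five_eighths_of_simple :=
  IsRestrictionMeasure.eq_five_eighths_of_simple_of_two_bubble_leaves hμex
    SLEBubbles.lintegral_poissonAvoidance_eq_rpow_holds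

/-- **[LSW] p. 5 result 2 (`LawlerSchrammWerner2003_unique`) from the Brownian bubble measure alone.**
[cite: LawlerSchrammWerner2003Restriction, p. 5 result 2] -/
theorem LawlerSchrammWerner2003_unique_of_bubble_measure (hμex : exists_isBrownianBubbleMeasure) :
    LawlerSchrammWerner2003_unique :=
  LawlerSchrammWerner2003_unique_of_two_bubble_leaves hμex SLEBubbles.lintegral_poissonAvoidance_eq_rpow_holds

end Literature.Probability.RandomPlanarGeometry

end
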